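import Mathlib
import Literature.Analysis.UnboundedOperators.HeatKernelHeatEquation
import Literature.Analysis.UnboundedOperators.HeatKernelGradient

/-!
# Route PlaneEnergyCeiling · crux `PlanarEnergyAPriori` — the 1-D heat kernel of the slab law

Helper file for the crux item stmt-NavierStokesRegularity-16855 (`PlanarEnergyAPriori`, route
`PlaneEnergyCeiling`), toward the registered stub `stub_slabLawMild` of the line
`Cruxes/PlanarEnergyAPriori/Lines/birth.lean` (THE SLAB ENERGY LAW IN MILD FORM). The slab law
`∂ₜE = ν∂²_cE − 2∂_cF − 2νD` is a 1-D heat equation in the offset `c`; its mild form tests `E`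
against the backward kernel `c ↦ G_{ν(t−s)}(c − c₀)`. This file is the ONE-DIMENSIONAL KERNEL
CALCULUS, over the accepted Gauss–Weierstrass kernel
`Literature.Analysis.UnboundedOperators.heatKernel σ z = (4πσ)^{-1/2} e^{-z²/(4σ)}` (`E = ℝ`):

* `heatKernel_real_eq`, `hasDerivAt_heatKernel_real`, `hasDerivAt_deriv_heatKernel_real`,
  `hasDerivAt_heatKernel_real_time` — the explicit formula, `∂_z G_σ = −(z/2σ) G_σ`,
  `∂²_z G_σ = (z²/4σ² − 1/2σ) G_σ = ∂_σ G_σ` (the heat equation with unit diffusivity);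
* `abs_deriv_heatKernel_real_le`, `abs_deriv2_heatKernel_real_le` — sup bounds
  `|∂_zG_σ| ≤ (4πσ)^{-1/2}(1+4σ)/(4σ)`, `|∂²_zG_σ| ≤ (4πσ)^{-1/2} · 3/(2σ)`;
* `integral_deriv_heatKernel_real = 0` and the sharp `L¹` norm of the derivative
  `∫ |∂_z G_σ| = (π σ)^{-1/2}` (`lintegral_enorm_deriv_heatKernel_real`), which is the weight
  `(√(πν(t−s)))⁻¹` of the registered stub;
* `tendsto_integral_mul_heatKernel` — the approximate identity along a time-dependent family:
  if `e(s,·) → e(t,·)` uniformly at rate `L(t−s)` and `e(t,·)` is bounded continuous, then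
  `∫ e(s,c) G_{ν(t−s)}(c − c₀) dc → e(t,c₀)` as `s ↑ t` (accepted
  `tendsto_heatExtension_nhdsWithin_prod` + the maximum principle).

Folklore (Evans, *PDE*, §2.3.1); Mathlib + the accepted `UnboundedOperators.HeatKernel*` files.
-/

noncomputable section

-- single-conjunct summit: `Summit.<Summit>.<Problem>` repeats the name by the D-0017 layout
set_option linter.dupNamespace false

namespace Summit.NavierStokesRegularity.NavierStokesRegularity.Theorems.PlanarEnergyAPriori

open MeasureTheory Set Filter Topology Real
open scoped ENNReal
open Literature.Analysis.UnboundedOperators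

/-! ### The kernel and its derivatives -/

/-- The 1-D Gauss–Weierstrass kernel explicitly: `G_σ(z) = (4πσ)^{-1/2} e^{-z²/(4σ)}`. -/
theorem heatKernel_real_eq (σ z : ℝ) :
    heatKernel σ z = (4 * π * σ) ^ (-(1 : ℝ) / 2) * Real.exp (-z ^ 2 / (4 * σ)) := by
  simp [heatKernel, Module.finrank_self, Real.norm_eq_abs, sq_abs]

/-- The kernel is even: `G_σ(a − b) = G_σ(b − a)`. -/
theorem heatKernel_sub_comm (σ a b : ℝ) : heatKernel σ (a - b) = heatKernel σ (b - a) := by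
  simp only [heatKernel, norm_sub_rev]

/-- `(4πσ)^{-1/2} = (2√(πσ))⁻¹` for `0 < σ`. -/
theorem rpow_neg_half_eq {σ : ℝ} (hσ : 0 < σ) :
    (4 * π * σ) ^ (-(1 : ℝ) / 2) = (2 * Real.sqrt (π * σ))⁻¹ := by
  have h4 : Real.sqrt 4 = 2 := by
    rw [show (4 : ℝ) = 2 ^ 2 by norm_num, Real.sqrt_sq (by norm_num : (0 : ℝ) ≤ 2)]
  rw [show -(1 : ℝ) / 2 = -(1 / 2 : ℝ) by ring, Real.rpow_neg (by positivity), ← Real.sqrt_eq_rpow,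
    show 4 * π * σ = 4 * (π * σ) by ring, Real.sqrt_mul (by norm_num : (0 : ℝ) ≤ 4), h4]

/-- The value at the origin: `G_σ(0) = (4πσ)^{-1/2}`. -/
theorem heatKernel_real_zero {σ : ℝ} : heatKernel σ (0 : ℝ) = (4 * π * σ) ^ (-(1 : ℝ) / 2) := by
  simp [heatKernel_real_eq]

/-- Sup bound: `G_σ(z) ≤ (4πσ)^{-1/2}` for `0 < σ`. -/
theorem heatKernel_real_le {σ : ℝ} (hσ : 0 < σ) (z : ℝ) :
    heatKernel σ z ≤ (4 * π * σ) ^ (-(1 : ℝ) / 2) := by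
  rw [heatKernel_real_eq]
  refine mul_le_of_le_one_right (by positivity) ?_
  rw [Real.exp_le_one_iff]
  exact div_nonpos_of_nonpos_of_nonneg (neg_nonpos.2 (sq_nonneg z)) (by positivity)

/-- **Space derivative** `∂_z G_σ(z) = −(z/(2σ)) G_σ(z)` (every real `σ`, junk-consistent). -/
theorem hasDerivAt_heatKernel_real (σ z : ℝ) :
    HasDerivAt (heatKernel σ) (-(z / (2 * σ)) * heatKernel σ z) z := by
  have h := (hasFDerivAt_heatKernel (E := ℝ) σ z).hasDerivAt
  convert h using 1
  simp
  ring

/-- The derivative as a function. -/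
theorem deriv_heatKernel_real (σ : ℝ) : deriv (heatKernel (E := ℝ) σ) = fun z => -(z / (2 * σ)) * heatKernel σ z :=
  funext fun z => (hasDerivAt_heatKernel_real σ z).deriv

/-- The kernel is differentiable in space. -/
theorem differentiable_heatKernel_real (σ : ℝ) : Differentiable ℝ (heatKernel (E := ℝ) σ) :=
  fun z => (hasDerivAt_heatKernel_real σ z).differentiableAt

/-- **Second space derivative** `∂²_z G_σ(z) = (z²/(4σ²) − 1/(2σ)) G_σ(z)`. -/
theorem hasDerivAt_deriv_heatKernel_real (σ z : ℝ) :
    HasDerivAt (fun z => -(z / (2 * σ)) * heatKernel σ z)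
      ((z ^ 2 / (4 * σ ^ 2) - 1 / (2 * σ)) * heatKernel σ z) z := by
  have h1 : HasDerivAt (fun z : ℝ => -(z / (2 * σ))) (-(1 / (2 * σ))) z := by
    have h0 : HasDerivAt (fun z : ℝ => z / (2 * σ)) (1 / (2 * σ)) z := by
      simpa using (hasDerivAt_id z).div_const (2 * σ)
    exact h0.fun_neg
  have h := h1.mul (hasDerivAt_heatKernel_real σ z)
  exact h.congr_deriv (by ring)

/-- **Time derivative** `∂_σ G_σ(z) = (z²/(4σ²) − 1/(2σ)) G_σ(z)` for `0 < σ`; with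
`hasDerivAt_deriv_heatKernel_real` this is the heat equation `∂_σ G = ∂²_z G`. -/
theorem hasDerivAt_heatKernel_real_time {σ : ℝ} (hσ : 0 < σ) (z : ℝ) :
    HasDerivAt (fun s => heatKernel s z) ((z ^ 2 / (4 * σ ^ 2) - 1 / (2 * σ)) * heatKernel σ z) σ := by
  have h := hasDerivAt_heatKernel_time (E := ℝ) hσ z
  convert h using 2
  simp [Module.finrank_self, Real.norm_eq_abs, sq_abs]

/-- The backward kernel in the time of the slab law: for `0 < ν(t − s)`,
`∂_s G_{ν(t−s)}(z) = −ν (z²/(4σ²) − 1/(2σ)) G_σ(z)`, `σ = ν(t−s)` — minus `ν` times the second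
space derivative (backward heat equation with diffusivity `ν`). -/
theorem hasDerivAt_heatKernel_backward {ν t s : ℝ} (h : 0 < ν * (t - s)) (z : ℝ) :
    HasDerivAt (fun s' => heatKernel (ν * (t - s')) z)
      (-ν * ((z ^ 2 / (4 * (ν * (t - s)) ^ 2) - 1 / (2 * (ν * (t - s)))) * heatKernel (ν * (t - s)) z)) s := by
  have hin : HasDerivAt (fun s' : ℝ => ν * (t - s')) (-ν) s := by
    simpa using ((hasDerivAt_id s).const_sub t).const_mul ν
  have h2 := (hasDerivAt_heatKernel_real_time h z).comp s hin
  have h3 : HasDerivAt (fun s' => heatKernel (ν * (t - s')) z)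
      ((z ^ 2 / (4 * (ν * (t - s)) ^ 2) - 1 / (2 * (ν * (t - s)))) * heatKernel (ν * (t - s)) z * (-ν)) s :=
    h2
  exact h3.congr_deriv (by ring)

/-! ### Sup bounds on the derivatives -/

/-- `z² e^{-z²/(4σ)} ≤ 4σ` for `0 < σ` (from `1 + a ≤ eᵃ`). -/
theorem sq_mul_exp_neg_le {σ : ℝ} (hσ : 0 < σ) (z : ℝ) : z ^ 2 * Real.exp (-z ^ 2 / (4 * σ)) ≤ 4 * σ := by
  have ha : 0 ≤ z ^ 2 / (4 * σ) := by positivity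
  have hexp : 1 + z ^ 2 / (4 * σ) ≤ Real.exp (z ^ 2 / (4 * σ)) := by
    have := Real.add_one_le_exp (z ^ 2 / (4 * σ)); linarith
  have hpos : 0 < Real.exp (z ^ 2 / (4 * σ)) := Real.exp_pos _
  rw [neg_div, Real.exp_neg, ← div_eq_mul_inv, div_le_iff₀ hpos]
  calc z ^ 2 = 4 * σ * (z ^ 2 / (4 * σ)) := by field_simp
    _ ≤ 4 * σ * (1 + z ^ 2 / (4 * σ)) := by nlinarith
    _ ≤ 4 * σ * Real.exp (z ^ 2 / (4 * σ)) := by gcongr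

/-- `e^{-z²/(4σ)} ≤ 1`. -/
theorem exp_neg_sq_div_le_one {σ : ℝ} (hσ : 0 < σ) (z : ℝ) : Real.exp (-z ^ 2 / (4 * σ)) ≤ 1 := by
  rw [Real.exp_le_one_iff]
  exact div_nonpos_of_nonpos_of_nonneg (neg_nonpos.2 (sq_nonneg z)) (by positivity)

/-- **Sup bound on `∂_z G_σ`**: `|∂_zG_σ(z)| ≤ (4πσ)^{-1/2} (1 + 4σ)/(4σ)` (using `|z| ≤ (1+z²)/2`
and `z²e^{-z²/4σ} ≤ 4σ`). -/
theorem abs_deriv_heatKernel_real_le {σ : ℝ} (hσ : 0 < σ) (z : ℝ) :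
    |-(z / (2 * σ)) * heatKernel σ z| ≤ (4 * π * σ) ^ (-(1 : ℝ) / 2) * ((1 + 4 * σ) / (4 * σ)) := by
  set A : ℝ := (4 * π * σ) ^ (-(1 : ℝ) / 2) with hA
  have hA0 : 0 < A := by positivity
  set e : ℝ := Real.exp (-z ^ 2 / (4 * σ)) with he
  have he0 : 0 < e := Real.exp_pos _
  have he1 : e ≤ 1 := exp_neg_sq_div_le_one hσ z
  have hz2 : z ^ 2 * e ≤ 4 * σ := sq_mul_exp_neg_le hσ z
  have habs : |z| ≤ (1 + z ^ 2) / 2 := by nlinarith [sq_nonneg (|z| - 1), sq_abs z, abs_nonneg z]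
  rw [heatKernel_real_eq, ← hA, ← he, abs_mul, abs_neg, abs_div, abs_of_pos (by positivity : (0 : ℝ) < 2 * σ),
    abs_of_pos (mul_pos hA0 he0)]
  calc |z| / (2 * σ) * (A * e) = A * (|z| * e) / (2 * σ) := by ring
    _ ≤ A * ((1 + z ^ 2) / 2 * e) / (2 * σ) := by gcongr
    _ = A * (e + z ^ 2 * e) / (4 * σ) := by ring
    _ ≤ A * (1 + 4 * σ) / (4 * σ) := by gcongr
    _ = A * ((1 + 4 * σ) / (4 * σ)) := by ring

/-- **Sup bound on `∂²_z G_σ`**: `|∂²_zG_σ(z)| ≤ (4πσ)^{-1/2} · 3/(2σ)`. -/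
theorem abs_deriv2_heatKernel_real_le {σ : ℝ} (hσ : 0 < σ) (z : ℝ) :
    |(z ^ 2 / (4 * σ ^ 2) - 1 / (2 * σ)) * heatKernel σ z| ≤ (4 * π * σ) ^ (-(1 : ℝ) / 2) * (3 / (2 * σ)) := by
  set A : ℝ := (4 * π * σ) ^ (-(1 : ℝ) / 2) with hA
  have hA0 : 0 < A := by positivity
  set e : ℝ := Real.exp (-z ^ 2 / (4 * σ)) with he
  have he0 : 0 < e := Real.exp_pos _
  have he1 : e ≤ 1 := exp_neg_sq_div_le_one hσ z
  have hz2 : z ^ 2 * e ≤ 4 * σ := sq_mul_exp_neg_le hσ z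
  rw [heatKernel_real_eq, ← hA, ← he, abs_mul, abs_of_pos (mul_pos hA0 he0)]
  have htri : |z ^ 2 / (4 * σ ^ 2) - 1 / (2 * σ)| ≤ z ^ 2 / (4 * σ ^ 2) + 1 / (2 * σ) := by
    refine (abs_sub _ _).trans ?_
    rw [abs_of_nonneg (by positivity), abs_of_nonneg (by positivity)]
  calc |z ^ 2 / (4 * σ ^ 2) - 1 / (2 * σ)| * (A * e)
      ≤ (z ^ 2 / (4 * σ ^ 2) + 1 / (2 * σ)) * (A * e) := by gcongr
    _ = A * ((z ^ 2 * e) / (4 * σ ^ 2) + e / (2 * σ)) := by ring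
    _ ≤ A * ((4 * σ) / (4 * σ ^ 2) + 1 / (2 * σ)) := by gcongr
    _ = A * (3 / (2 * σ)) := by field_simp; ring

/-! ### Integrals -/

/-- `∫ G_σ = 1` (`0 < σ`). -/
theorem integral_heatKernel_real {σ : ℝ} (hσ : 0 < σ) : ∫ z : ℝ, heatKernel σ z = 1 :=
  integral_heatKernel_eq_one_holds hσ

/-- `G_σ` is integrable (`0 < σ`). -/
theorem integrable_heatKernel_real {σ : ℝ} (hσ : 0 < σ) : Integrable (heatKernel (E := ℝ) σ) :=
  integrable_heatKernel_holds hσ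

/-- `∫⁻ ‖G_σ‖ₑ = 1` (`0 < σ`). -/
theorem lintegral_enorm_heatKernel_real {σ : ℝ} (hσ : 0 < σ) : ∫⁻ z : ℝ, ‖heatKernel σ z‖ₑ = 1 :=
  lintegral_enorm_heatKernel hσ

/-- `z² e^{-bz²}`-type integrability: `z ↦ z² G_σ(z)` is integrable (`0 < σ`). -/
theorem integrable_sq_mul_heatKernel_real {σ : ℝ} (hσ : 0 < σ) : Integrable fun z => z ^ 2 * heatKernel σ z := by
  have hb : 0 < 1 / (4 * σ) := by positivity
  have h := (integrable_rpow_mul_exp_neg_mul_sq hb (by norm_num : (-1 : ℝ) < 2)).const_mul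
    ((4 * π * σ) ^ (-(1 : ℝ) / 2))
  refine h.congr (Eventually.of_forall fun z => ?_)
  simp only [heatKernel_real_eq]
  rw [show (2 : ℝ) = ((2 : ℕ) : ℝ) by norm_num, Real.rpow_natCast]
  have : -(1 / (4 * σ)) * z ^ 2 = -z ^ 2 / (4 * σ) := by ring
  rw [this]; ring

/-- `z ↦ |z| G_σ(z)`-type integrability: the derivative `∂_zG_σ` is integrable (`0 < σ`). -/
theorem integrable_deriv_heatKernel_real {σ : ℝ} (hσ : 0 < σ) :
    Integrable fun z => -(z / (2 * σ)) * heatKernel σ z := by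
  have hb : 0 < 1 / (4 * σ) := by positivity
  have h := (integrable_mul_exp_neg_mul_sq hb).const_mul (-((4 * π * σ) ^ (-(1 : ℝ) / 2)) / (2 * σ))
  refine h.congr (Eventually.of_forall fun z => ?_)
  simp only [heatKernel_real_eq]
  have : -(1 / (4 * σ)) * z ^ 2 = -z ^ 2 / (4 * σ) := by ring
  rw [this]; ring

/-- The second derivative `∂²_zG_σ` is integrable (`0 < σ`). -/
theorem integrable_deriv2_heatKernel_real {σ : ℝ} (hσ : 0 < σ) :
    Integrable fun z => (z ^ 2 / (4 * σ ^ 2) - 1 / (2 * σ)) * heatKernel σ z := by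
  have h1 := (integrable_sq_mul_heatKernel_real hσ).const_mul (1 / (4 * σ ^ 2))
  have h2 := (integrable_heatKernel_real hσ).const_mul (1 / (2 * σ))
  refine (h1.sub h2).congr (Eventually.of_forall fun z => ?_)
  simp only [Pi.sub_apply]
  ring

/-- The kernel tends to `0` at `+∞`. -/
theorem tendsto_heatKernel_real_atTop {σ : ℝ} (hσ : 0 < σ) : Tendsto (heatKernel (E := ℝ) σ) atTop (𝓝 0) := by
  have h1 : Tendsto (fun z : ℝ => -z ^ 2 / (4 * σ)) atTop atBot := by
    have h0 : Tendsto (fun z : ℝ => z ^ 2 / (4 * σ)) atTop atTop :=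
      Tendsto.atTop_div_const (by positivity) (tendsto_pow_atTop two_ne_zero)
    refine (tendsto_neg_atTop_atBot.comp h0).congr fun z => ?_
    simp [Function.comp, neg_div]
  have h2 := (Real.tendsto_exp_atBot.comp h1).const_mul ((4 * π * σ) ^ (-(1 : ℝ) / 2))
  rw [mul_zero] at h2
  refine h2.congr fun z => ?_
  simp [heatKernel_real_eq, Function.comp]

/-- The kernel tends to `0` at `−∞`. -/
theorem tendsto_heatKernel_real_atBot {σ : ℝ} (hσ : 0 < σ) : Tendsto (heatKernel (E := ℝ) σ) atBot (𝓝 0) := by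
  have h := (tendsto_heatKernel_real_atTop hσ).comp tendsto_neg_atBot_atTop
  refine h.congr fun z => ?_
  simp [Function.comp, heatKernel, norm_neg]

/-- `∫_{(0,∞)} (z/(2σ)) G_σ = G_σ(0)` (FTC with the antiderivative `−G_σ`). -/
theorem integral_Ioi_mul_heatKernel_real {σ : ℝ} (hσ : 0 < σ) :
    ∫ z in Ioi (0 : ℝ), z / (2 * σ) * heatKernel σ z = heatKernel σ (0 : ℝ) := by
  have hderiv : ∀ z ∈ Ioi (0 : ℝ), HasDerivAt (fun z : ℝ => -heatKernel σ z) (z / (2 * σ) * heatKernel σ z) z := by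
    intro z _
    exact (hasDerivAt_heatKernel_real σ z).fun_neg.congr_deriv (by ring)
  have hint : IntegrableOn (fun z : ℝ => z / (2 * σ) * heatKernel σ z) (Ioi 0) := by
    have := (integrable_deriv_heatKernel_real hσ).neg
    refine (this.congr (Eventually.of_forall fun z => ?_)).integrableOn
    simp only [Pi.neg_apply]; ring
  have hcont : ContinuousWithinAt (fun z : ℝ => -heatKernel σ z) (Ici 0) 0 :=
    (continuous_heatKernel (E := ℝ) σ).neg.continuousWithinAt
  have hlim : Tendsto (fun z : ℝ => -heatKernel σ z) atTop (𝓝 (-0)) := (tendsto_heatKernel_real_atTop hσ).neg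
  have h := integral_Ioi_of_hasDerivAt_of_tendsto hcont hderiv hint hlim
  rw [h]; ring

/-- `∫_{(−∞,0]} (−z/(2σ)) G_σ = G_σ(0)` (FTC with the antiderivative `G_σ`). -/
theorem integral_Iic_neg_mul_heatKernel_real {σ : ℝ} (hσ : 0 < σ) :
    ∫ z in Iic (0 : ℝ), -(z / (2 * σ)) * heatKernel σ z = heatKernel σ (0 : ℝ) := by
  have hderiv : ∀ z ∈ Iio (0 : ℝ), HasDerivAt (heatKernel (E := ℝ) σ) (-(z / (2 * σ)) * heatKernel σ z) z :=
    fun z _ => hasDerivAt_heatKernel_real σ z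
  have hint : IntegrableOn (fun z : ℝ => -(z / (2 * σ)) * heatKernel σ z) (Iic 0) :=
    (integrable_deriv_heatKernel_real hσ).integrableOn
  have hcont : ContinuousWithinAt (heatKernel (E := ℝ) σ) (Iic 0) 0 :=
    (continuous_heatKernel (E := ℝ) σ).continuousWithinAt
  have h := integral_Iic_of_hasDerivAt_of_tendsto hcont hderiv hint (tendsto_heatKernel_real_atBot hσ)
  rw [h]; ring

/-- **`∫ ∂_zG_σ = 0`** (`0 < σ`). -/
theorem integral_deriv_heatKernel_real {σ : ℝ} (hσ : 0 < σ) : ∫ z : ℝ, -(z / (2 * σ)) * heatKernel σ z = 0 := by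
  have hint := integrable_deriv_heatKernel_real hσ
  rw [← intervalIntegral.integral_Iic_add_Ioi (b := 0) hint.integrableOn hint.integrableOn,
    integral_Iic_neg_mul_heatKernel_real hσ]
  have : ∫ z in Ioi (0 : ℝ), -(z / (2 * σ)) * heatKernel σ z = -heatKernel σ (0 : ℝ) := by
    rw [← integral_Ioi_mul_heatKernel_real hσ, ← integral_neg]
    refine integral_congr_ae (Eventually.of_forall fun z => ?_)
    ring
  rw [this]; ring

/-- **The sharp `L¹` norm of `∂_zG_σ`**: `∫ |∂_zG_σ(z)| dz = 2G_σ(0) = (√(πσ))⁻¹` (`0 < σ`). -/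
theorem integral_abs_deriv_heatKernel_real {σ : ℝ} (hσ : 0 < σ) :
    ∫ z : ℝ, |-(z / (2 * σ)) * heatKernel σ z| = (Real.sqrt (π * σ))⁻¹ := by
  have hint := (integrable_deriv_heatKernel_real hσ).abs
  have hpos : ∀ z : ℝ, 0 < heatKernel σ z := heatKernel_pos hσ
  -- on `(−∞, 0]` the derivative is nonnegative, on `(0, ∞)` nonpositive
  have hL : ∫ z in Iic (0 : ℝ), |-(z / (2 * σ)) * heatKernel σ z| = heatKernel σ (0 : ℝ) := by
    rw [← integral_Iic_neg_mul_heatKernel_real hσ]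
    refine setIntegral_congr_fun measurableSet_Iic fun z hz => ?_
    rw [abs_of_nonneg]
    exact mul_nonneg (neg_nonneg.2 (div_nonpos_of_nonpos_of_nonneg hz (by positivity))) (hpos z).le
  have hR : ∫ z in Ioi (0 : ℝ), |-(z / (2 * σ)) * heatKernel σ z| = heatKernel σ (0 : ℝ) := by
    rw [← integral_Ioi_mul_heatKernel_real hσ]
    refine setIntegral_congr_fun measurableSet_Ioi fun z hz => ?_
    rw [neg_mul, abs_neg, abs_of_nonneg]
    exact mul_nonneg (div_nonneg (le_of_lt hz) (by positivity)) (hpos z).le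
  rw [← intervalIntegral.integral_Iic_add_Ioi (b := 0) hint.integrableOn hint.integrableOn, hL, hR,
    heatKernel_real_zero, rpow_neg_half_eq hσ]
  have : 0 < Real.sqrt (π * σ) := Real.sqrt_pos.2 (by positivity)
  field_simp
  ring

/-- The same in `ℝ≥0∞`: `∫⁻ ‖∂_zG_σ‖ₑ = ofReal ((√(πσ))⁻¹)` — the weight of the mild slab law. -/
theorem lintegral_enorm_deriv_heatKernel_real {σ : ℝ} (hσ : 0 < σ) :
    ∫⁻ z : ℝ, ‖-(z / (2 * σ)) * heatKernel σ z‖ₑ = ENNReal.ofReal ((Real.sqrt (π * σ))⁻¹) := by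
  rw [← ofReal_integral_norm_eq_lintegral_enorm (integrable_deriv_heatKernel_real hσ)]
  simp_rw [Real.norm_eq_abs, integral_abs_deriv_heatKernel_real hσ]

/-! ### The approximate identity along a time-dependent family -/

/-- A weighted integral against the shifted kernel is the caloric extension:
`∫ g(c) G_σ(c − c₀) dc = e^{σΔ} g (c₀)`. -/
theorem integral_mul_heatKernel_sub_eq_heatExtension (g : ℝ → ℝ) (σ c₀ : ℝ) :
    ∫ c, g c * heatKernel σ (c - c₀) = heatExtension g σ c₀ := by
  rw [heatExtension_eq_integral_sub]
  refine integral_congr_ae (Eventually.of_forall fun c => ?_)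
  simp only [smul_eq_mul]
  rw [mul_comm, heatKernel_sub_comm]

/-- **Approximate identity along a time-dependent family.** Let `e : ℝ → ℝ → ℝ` have continuous,
uniformly bounded slices, with `e(s,·) → e(t,·)` uniformly at rate `L(t − s)` as `s ↑ t`. Then for
`ν > 0` and every `c₀`: `∫ e(s,c) G_{ν(t−s)}(c − c₀) dc → e(t,c₀)` as `s ↑ t`. (Split
`e(s,·) = (e(s,·) − e(t,·)) + e(t,·)`: the first part is `≤ L(t−s)` by the maximum principle, the
second is `e^{ν(t−s)Δ}e(t,·)(c₀) → e(t,c₀)`, accepted `tendsto_heatExtension_nhdsWithin_prod`.) -/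
theorem tendsto_integral_mul_heatKernel {e : ℝ → ℝ → ℝ} {t ν M L : ℝ} (hν : 0 < ν)
    (hcont : ∀ s, Continuous (e s)) (hM : ∀ s c, ‖e s c‖ ≤ M)
    (hL : ∀ s < t, ∀ c, ‖e s c - e t c‖ ≤ L * (t - s)) (c₀ : ℝ) :
    Tendsto (fun s => ∫ c, e s c * heatKernel (ν * (t - s)) (c - c₀)) (𝓝[<] t) (𝓝 (e t c₀)) := by
  -- the caloric extension of the final slice
  have hσ : ∀ s < t, 0 < ν * (t - s) := fun s hs => mul_pos hν (by linarith)
  have h2 : Tendsto (fun s => heatExtension (e t) (ν * (t - s)) c₀) (𝓝[<] t) (𝓝 (e t c₀)) := by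
    have hT := tendsto_heatExtension_nhdsWithin_prod (hcont t) (hM t) c₀
    have hmap : Tendsto (fun s : ℝ => (ν * (t - s), c₀)) (𝓝[<] t) (𝓝[Ioi 0 ×ˢ univ] ((0 : ℝ), c₀)) := by
      refine tendsto_nhdsWithin_iff.2 ⟨?_, ?_⟩
      · have hc : Continuous fun s : ℝ => (ν * (t - s), c₀) := by fun_prop
        have := hc.tendsto t
        simp only [sub_self, mul_zero] at this
        exact this.mono_left nhdsWithin_le_nhds
      · filter_upwards [self_mem_nhdsWithin] with s hs
        show (ν * (t - s), c₀) ∈ Ioi (0 : ℝ) ×ˢ (univ : Set ℝ)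
        exact ⟨hσ s hs, mem_univ _⟩
    have h2' := hT.comp hmap
    simpa only [Function.comp_def] using h2'
  -- the difference part is `O(t - s)`
  have h1 : Tendsto (fun s => ∫ c, (e s c - e t c) * heatKernel (ν * (t - s)) (c - c₀)) (𝓝[<] t) (𝓝 0) := by
    have hbound : ∀ s < t, ‖∫ c, (e s c - e t c) * heatKernel (ν * (t - s)) (c - c₀)‖ ≤ L * (t - s) := by
      intro s hs
      have hK : Integrable fun c => heatKernel (ν * (t - s)) (c - c₀) :=
        (integrable_heatKernel_real (hσ s hs)).comp_sub_right c₀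
      calc ‖∫ c, (e s c - e t c) * heatKernel (ν * (t - s)) (c - c₀)‖
          ≤ ∫ c, L * (t - s) * heatKernel (ν * (t - s)) (c - c₀) := by
            refine norm_integral_le_of_norm_le (hK.const_mul _) (Eventually.of_forall fun c => ?_)
            rw [norm_mul, Real.norm_of_nonneg (heatKernel_pos (hσ s hs) _).le]
            exact mul_le_mul_of_nonneg_right (hL s hs c) (heatKernel_pos (hσ s hs) _).le
        _ = L * (t - s) := by
            rw [integral_const_mul, integral_sub_right_eq_self (heatKernel (ν * (t - s))) c₀,
              integral_heatKernel_real (hσ s hs), mul_one]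
    have hlim : Tendsto (fun s : ℝ => L * (t - s)) (𝓝[<] t) (𝓝 0) := by
      have hc : Continuous fun s : ℝ => L * (t - s) := by fun_prop
      have := hc.tendsto t
      simp only [sub_self, mul_zero] at this
      exact this.mono_left nhdsWithin_le_nhds
    refine squeeze_zero_norm' ?_ hlim
    filter_upwards [self_mem_nhdsWithin] with s hs
    exact hbound s hs
  -- add the two parts
  have hsum := h1.add h2
  rw [zero_add] at hsum
  refine hsum.congr' ?_
  filter_upwards [self_mem_nhdsWithin] with s hs
  have hK : Integrable fun c => heatKernel (ν * (t - s)) (c - c₀) :=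
    (integrable_heatKernel_real (hσ s hs)).comp_sub_right c₀
  have hi1 : Integrable fun c => (e s c - e t c) * heatKernel (ν * (t - s)) (c - c₀) := by
    refine hK.bdd_mul (c := 2 * M) ?_ (Eventually.of_forall fun c => ?_)
    · exact ((hcont s).sub (hcont t)).aestronglyMeasurable
    · calc ‖e s c - e t c‖ ≤ ‖e s c‖ + ‖e t c‖ := norm_sub_le _ _
        _ ≤ M + M := add_le_add (hM s c) (hM t c)
        _ = 2 * M := by ring
  have hi2 : Integrable fun c => e t c * heatKernel (ν * (t - s)) (c - c₀) :=
    hK.bdd_mul (hcont t).aestronglyMeasurable (Eventually.of_forall fun c => hM t c)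
  rw [← integral_mul_heatKernel_sub_eq_heatExtension, ← integral_add hi1 hi2]
  refine integral_congr_ae (Eventually.of_forall fun c => ?_)
  ring

/-- **The weight of the mild slab law, registered form** (sub-goal `slabLaw_kernelWeight` of
stmt-NavierStokesRegularity-16855): the `L¹` norm of the space derivative of the 1-D heat kernel,
`∫ |∂_z G_σ| = (√(πσ))⁻¹` in `ℝ≥0∞`; with `σ = ν(t − s)` this is the factor
`(√(πν(t−s)))⁻¹` of the registered stub `stub_slabLawMild`. [folklore] -/
theorem slabLaw_kernelWeight : ∀ (σ : ℝ), 0 < σ → ∫⁻ z : ℝ, ‖-(z / (2 * σ)) * Literature.Analysis.UnboundedOperators.heatKernel σ z‖ₑ = ENNReal.ofReal ((Real.sqrt (Real.pi * σ))⁻¹) :=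
  fun _ hσ => lintegral_enorm_deriv_heatKernel_real hσ

end Summit.NavierStokesRegularity.NavierStokesRegularity.Theorems.PlanarEnergyAPriori

end
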